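import Literature.MathematicalPhysics.MHD.ScrewPinchStability
import Literature.MathematicalPhysics.MHD.MercierCriterion
import HarnessLib

/-!
# F1.SUYDAM — the force-balanced FRS1 screw-pinch FAMILY `B_z ≡ 1`, `B_θ = r·c/(1 + r²)`, `p = c²/(2(1 + r²)²) − c²/8 + δ`:
# Suydam's criterion in CLOSED FORM (fails in the core `r² < t_S(c)`, holds outside), the Newcomb–Suydam negative-energy
# displacement for every core-resonant helicity, and the toroidal `(1 − q²)` sign reversal (kernel remark)
(venture LADDER-GRIDFUSION, rung F1 «Suydam … typed as theorems-as-printed + CERTIFIED evaluation» and MODEL-VALIDITY of the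
F3.σ rows; cell `gridfusion`, seat `gridfusion-model-7` (g2), 2026-08-27; 0 kit, exact algebra only.  The two INSTANCES of
record — gridfusion-lit-4's MODEL M `EqSigmaR5.hl5` (`c = 1/7`, `R₀ = 5a`, #66) and `EqSigmaR10.hl10` (`c = 1/14`, `R₀ = 10a`,
«#66′ R10») — are treated in the companion `Models/TearingFRS1EqSuydamInstances.lean`, which PROVES `hl5.toProfile =
eqProfile (1/7) (1/19600)` etc., so everything here applies to them literally.  Inputs BY NAME: gridfusion-lit-3's
`ScrewPinch.Profile.{pitch, suydamFun, SuydamCriterion, kDotB, fluidEnergy}` and the DISCHARGED named fact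
`ScrewPinch.Profile.suydamNecessity_holds` (`Literature/…/MHD/ScrewPinchStability.lean` §2/§5, p456675/p470054);
`Mercier.RadialProfile.{mercierCircularFun, MercierCircularCriterion, mercierCircularFun_pos_of_one_lt_q}`
(`Literature/…/MHD/MercierCriterion.lean` §3).)

## The statement (three columns, never merged)
MODEL FAMILY (MODELLED): the EXACT radially force-balanced screw pinch with uniform axial field, `μ₀ = 1`, `B_z ≡ 1`,
`B_θ = r·c/(1 + r²)`, `p = c²/(2(1 + r²)²) − c²/8 + δ` (`c = 1/(R₀q₀) ≠ 0`; `δ` = edge offset; `q = (1 + r²)/(R₀c)`); straight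
periodic cylinder, ideal MHD — `eqProfile c δ : ScrewPinch.Profile`.
CERTIFIED (kernel, this file), for every `c ≠ 0`, `δ`:
* §2 CLOSED FORM of Suydam's function (the tree's `suydamFun = r B_z²(q′/q)² + 8μ₀p′`, Freidberg (11.109)) off the axis:
  **`suydamFun(r) = 4r·(r²(1 + r²) − 4c²)/(1 + r²)³`** (`suydamFun_eq`; `q′/q = 2r/(1 + r²)`, `p′ = −2c²r/(1 + r²)³`); for
  `r > 0` it is NEGATIVE iff `r²(1 + r²) < 4c²` iff `r² < t_S(c) := (√(1 + 16c²) − 1)/2` and POSITIVE iff `r²(1 + r²) > 4c²`;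
  hence **Suydam's criterion FAILS on `(0, a)` for every `a > 0`** (`not_suydamCriterion`) — the pressure gradient is `O(r)` at
  the axis, the shear term `O(r³)`.
* §3 CONSEQUENCE by Newcomb–Suydam NECESSITY (`suydamNecessity_holds` is a tree THEOREM — no hypothesis is carried): for every
  `0 < r₀ < a` with `r₀² < t_S(c)` and every `m ≠ 0`, the mode `(m, k)` RESONANT at `r₀` (`k = −mc/(1 + r₀²)`) has a `C¹` radial
  trial displacement compactly supported in `(0, a)` — an admissible INTERNAL displacement — with NEGATIVE reduced ideal energy
  `∫₀ᵃ (f ξ′² + g ξ²) dr < 0` (`exists_negative_energy`).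
* §4 TOROIDAL CONTEXT (kernel remark on a DIFFERENT printed criterion): for `q = q₀(1 + r²)` with `q₀ > 1` and the same pressure
  (`p′ < 0`) the large-aspect-ratio CIRCULAR-TOKAMAK Mercier function `(rq′/q)² + 8μ₀rp′(1 − q²)/B_φ²` (Freidberg (12.86)) is
  POSITIVE at every `r > 0` (`mercierCircular_pos`), so `MercierCircularCriterion a` holds for every `a`: the factor
  `(1 − q²) < 0` reverses the sign of the pressure term exactly where the cylinder fails.
READING.  A negative-energy admissible displacement is ideal INSTABILITY of the MODEL in the energy-principle sense for that
helicity class (no growth rate claimed); it concerns localized INTERNAL interchanges resonant in the core and says nothing about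
other classes (e.g. a single `(2,1)` mode resonant outside the core, the class of the σ-rows).  MODELLED, not certified: that a
straight cylinder describes any torus (§4 is the printed large-aspect-ratio statement for the same profiles, not a theorem about
the cylinder); the dynamical reading of the energy principle (BFKK 1958).  Nothing here says any plasma or device is stable or
unstable.  VALIDATED: none needed (exact algebra).  No `native_decide`, no `decide`.
-/

noncomputable section

open Set
open Literature.MathematicalPhysics.MHD

namespace Summit.Ventures.FusionMHD.Models

namespace TearingFRS1

namespace EqSuydam

/-! ## §1 The force-balanced FRS1 family as screw-pinch `Profile` data, parametrised by `c = 1/(R₀ q₀)` -/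

/-- The force-balanced FRS1 screw pinch with uniform axial field as tree `ScrewPinch.Profile` data: `μ₀ = 1`, `B_z ≡ 1`,
`B_θ = r·c/(1 + r²)`, `p = c²/(2(1 + r²)²) − c²/8 + δ` (`c = 1/(R₀q₀)`, `δ` = edge pressure offset).  For `c = 1/7`,
`δ = 1/19600` this IS `hl5.toProfile` (`R₀ = 5a`) and for `c = 1/14`, `δ = 1/78400` it IS `hl10.toProfile` (`R₀ = 10a`)
— `eqProfile_one_seventh`, `eqProfile_one_fourteenth` of the companion Instances file. [instance data] -/
def eqProfile (c δ : ℝ) : ScrewPinch.Profile :=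
  { μ₀ := 1, Bθ := fun r => r * (c / (1 + r ^ 2)), Bz := fun _ => 1, p := fun r => c ^ 2 / (2 * (1 + r ^ 2) ^ 2) - c ^ 2 / 8 + δ }

variable {c δ : ℝ}

/-- The pitch `r B_z/B_θ = (1 + r²)/c` off the axis. [folklore] -/
theorem pitch_eq (c δ : ℝ) {r : ℝ} (hr : r ≠ 0) : (eqProfile c δ).pitch r = (1 + r ^ 2) / c := by
  show r * 1 / (r * (c / (1 + r ^ 2))) = (1 + r ^ 2) / c
  rw [mul_one, ← div_div, div_self hr, one_div_div]

/-- `d/dr pitch = 2r/c` off the axis (the pitch agrees with `(1 + r²)/c` on a neighbourhood of every `r ≠ 0`). [folklore] -/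
theorem deriv_pitch (c δ : ℝ) {r : ℝ} (hr : r ≠ 0) : deriv (eqProfile c δ).pitch r = 2 * r / c := by
  have hev : (eqProfile c δ).pitch =ᶠ[nhds r] fun s => (1 + s ^ 2) / c := by
    filter_upwards [eventually_ne_nhds hr] with s hs
    exact pitch_eq c δ hs
  rw [hev.deriv_eq]
  have h : HasDerivAt (fun s : ℝ => (1 + s ^ 2) / c) ((0 + (2 : ℕ) * r ^ (2 - 1)) / c) r :=
    ((hasDerivAt_const r (1 : ℝ)).add (hasDerivAt_pow 2 r)).div_const c
  rw [h.deriv]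
  push_cast
  ring

/-- `p′(r) = −2c²r/(1 + r²)³`. [folklore] -/
theorem hasDerivAt_p (r : ℝ) : HasDerivAt (eqProfile c δ).p (-(2 * c ^ 2 * r) / (1 + r ^ 2) ^ 3) r := by
  have h1 : (1 : ℝ) + r ^ 2 ≠ 0 := by positivity
  have hin : HasDerivAt (fun s : ℝ => 2 * (1 + s ^ 2) ^ 2) (2 * ((2 : ℕ) * (1 + r ^ 2) ^ (2 - 1) * (0 + (2 : ℕ) * r ^ (2 - 1)))) r :=
    (((hasDerivAt_const r (1 : ℝ)).add (hasDerivAt_pow 2 r)).pow 2).const_mul 2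
  have hq : HasDerivAt (fun s : ℝ => c ^ 2 / (2 * (1 + s ^ 2) ^ 2))
      ((0 * (2 * (1 + r ^ 2) ^ 2) - c ^ 2 * (2 * ((2 : ℕ) * (1 + r ^ 2) ^ (2 - 1) * (0 + (2 : ℕ) * r ^ (2 - 1)))))
        / (2 * (1 + r ^ 2) ^ 2) ^ 2) r :=
    (hasDerivAt_const r (c ^ 2)).div hin (by positivity)
  have h := (hq.sub_const (c ^ 2 / 8)).add_const δ
  have e : (0 * (2 * (1 + r ^ 2) ^ 2) - c ^ 2 * (2 * ((2 : ℕ) * (1 + r ^ 2) ^ (2 - 1) * (0 + (2 : ℕ) * r ^ (2 - 1)))))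
        / (2 * (1 + r ^ 2) ^ 2) ^ 2 = -(2 * c ^ 2 * r) / (1 + r ^ 2) ^ 3 := by
    push_cast
    field_simp
    ring
  rw [e] at h
  exact h

/-- `deriv p = −2c²r/(1 + r²)³`. [folklore] -/
theorem deriv_p (r : ℝ) : deriv (eqProfile c δ).p r = -(2 * c ^ 2 * r) / (1 + r ^ 2) ^ 3 := (hasDerivAt_p r).deriv

/-! ## §2 Suydam's function in closed form and its sign -/

/-- **CLOSED FORM**: `r B_z² (q′/q)² + 8μ₀p′ = 4r·(r²(1 + r²) − 4c²)/(1 + r²)³` off the axis. [cite: Freidberg2014, §11.5.2 eq. (11.109)] -/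
theorem suydamFun_eq (hc : c ≠ 0) {r : ℝ} (hr : r ≠ 0) :
    (eqProfile c δ).suydamFun r = 4 * r * (r ^ 2 * (1 + r ^ 2) - 4 * c ^ 2) / (1 + r ^ 2) ^ 3 := by
  unfold ScrewPinch.Profile.suydamFun
  rw [deriv_pitch c δ hr, pitch_eq c δ hr, deriv_p r]
  have h1 : (1 : ℝ) + r ^ 2 ≠ 0 := by positivity
  show r * (1 : ℝ) ^ 2 * (2 * r / c / ((1 + r ^ 2) / c)) ^ 2 + 8 * 1 * (-(2 * c ^ 2 * r) / (1 + r ^ 2) ^ 3)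
      = 4 * r * (r ^ 2 * (1 + r ^ 2) - 4 * c ^ 2) / (1 + r ^ 2) ^ 3
  field_simp
  ring

/-- Sign form: for `r > 0`, Suydam's function is NEGATIVE iff `r²(1 + r²) < 4c²`. [cite: Freidberg2014, §11.5.2 eq. (11.109)] -/
theorem suydamFun_neg_iff (hc : c ≠ 0) {r : ℝ} (hr : 0 < r) :
    (eqProfile c δ).suydamFun r < 0 ↔ r ^ 2 * (1 + r ^ 2) < 4 * c ^ 2 := by
  rw [suydamFun_eq hc hr.ne']
  have hD : (0 : ℝ) < (1 + r ^ 2) ^ 3 := by positivity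
  rw [div_lt_iff₀ hD, zero_mul]
  constructor
  · intro h; nlinarith
  · intro h; nlinarith

/-- Sign form: for `r > 0`, Suydam's function is POSITIVE iff `r²(1 + r²) > 4c²`. [cite: Freidberg2014, §11.5.2 eq. (11.109)] -/
theorem suydamFun_pos_iff (hc : c ≠ 0) {r : ℝ} (hr : 0 < r) :
    0 < (eqProfile c δ).suydamFun r ↔ 4 * c ^ 2 < r ^ 2 * (1 + r ^ 2) := by
  rw [suydamFun_eq hc hr.ne']
  have hD : (0 : ℝ) < (1 + r ^ 2) ^ 3 := by positivity
  rw [lt_div_iff₀ hD, zero_mul]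
  constructor
  · intro h; nlinarith
  · intro h; nlinarith

/-- The Suydam radius squared `t_S(c) = (√(1 + 16c²) − 1)/2`, the positive root of `t² + t = 4c²`. [folklore] -/
def tS (c : ℝ) : ℝ := (Real.sqrt (1 + 16 * c ^ 2) - 1) / 2

/-- `t_S² + t_S = 4c²`. [folklore] -/
theorem tS_sq_add (c : ℝ) : tS c ^ 2 + tS c = 4 * c ^ 2 := by
  unfold tS
  have h := Real.sq_sqrt (show (0 : ℝ) ≤ 1 + 16 * c ^ 2 by positivity)
  nlinarith [h]

/-- `t_S > 0` for `c ≠ 0`. [folklore] -/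
theorem tS_pos (hc : c ≠ 0) : 0 < tS c := by
  unfold tS
  have hc2 : 0 < c ^ 2 := by positivity
  have h1 : (1 : ℝ) < Real.sqrt (1 + 16 * c ^ 2) := (Real.lt_sqrt (by norm_num)).2 (by nlinarith)
  linarith

/-- For `t ≥ 0`: `t(1 + t) < 4c² ↔ t < t_S`. [folklore] -/
theorem mul_one_add_lt_iff {t : ℝ} (ht : 0 ≤ t) (c : ℝ) : t * (1 + t) < 4 * c ^ 2 ↔ t < tS c := by
  have key : t * (1 + t) - 4 * c ^ 2 = (t - tS c) * (t + tS c + 1) := by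
    have := tS_sq_add c; ring_nf; nlinarith [this]
  have hpos : 0 < t + tS c + 1 := by
    have : 0 ≤ tS c + 1 / 2 := by
      unfold tS; have := Real.sqrt_nonneg (1 + 16 * c ^ 2); linarith
    linarith
  constructor
  · intro h
    have : (t - tS c) * (t + tS c + 1) < 0 := by rw [← key]; linarith
    nlinarith
  · intro h
    have : (t - tS c) * (t + tS c + 1) < 0 := mul_neg_of_neg_of_pos (by linarith) hpos
    linarith [key]

/-- **EXACT SUYDAM RADIUS**: for `r > 0`, Suydam's criterion is violated at `r` iff `r² < t_S(c) = (√(1 + 16c²) − 1)/2`.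
[cite: Freidberg2014, §11.5.2 eq. (11.109)] -/
theorem suydamFun_neg_iff_sq_lt (hc : c ≠ 0) {r : ℝ} (hr : 0 < r) :
    (eqProfile c δ).suydamFun r < 0 ↔ r ^ 2 < tS c := by
  rw [suydamFun_neg_iff hc hr]
  exact mul_one_add_lt_iff (sq_nonneg r) c

/-- … and satisfied at `r` iff `r² > t_S(c)`. [cite: Freidberg2014, §11.5.2 eq. (11.109)] -/
theorem suydamFun_pos_iff_lt_sq (hc : c ≠ 0) {r : ℝ} (hr : 0 < r) :
    0 < (eqProfile c δ).suydamFun r ↔ tS c < r ^ 2 := by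
  rw [suydamFun_pos_iff hc hr]
  have h1 := mul_one_add_lt_iff (sq_nonneg r) c
  have key : r ^ 2 * (1 + r ^ 2) - 4 * c ^ 2 = (r ^ 2 - tS c) * (r ^ 2 + tS c + 1) := by
    have := tS_sq_add c; ring_nf; nlinarith [this]
  have hpos : 0 < r ^ 2 + tS c + 1 := by nlinarith [tS_pos hc, sq_nonneg r]
  constructor
  · intro h
    have : 0 < (r ^ 2 - tS c) * (r ^ 2 + tS c + 1) := by rw [← key]; linarith
    linarith [(mul_pos_iff_of_pos_right hpos).1 this]
  · intro h
    have : 0 < (r ^ 2 - tS c) * (r ^ 2 + tS c + 1) := mul_pos (by linarith) hpos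
    linarith [key]

/-- **THE CRITERION FAILS** on `(0, a)` for every `a > 0`: the core `0 < r < min(a, √t_S)` violates it.
[cite: Freidberg2014, §11.5.2 eq. (11.109)] -/
theorem not_suydamCriterion (hc : c ≠ 0) {a : ℝ} (ha : 0 < a) : ¬ (eqProfile c δ).SuydamCriterion a := by
  intro h
  -- the radius r = min (a/2) (√(t_S)/2) lies in (0,a) and has r² < t_S
  have htS := tS_pos hc
  set s := Real.sqrt (tS c) with hs
  have hs0 : 0 < s := Real.sqrt_pos.2 htS
  have hss : s ^ 2 = tS c := Real.sq_sqrt htS.le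
  set r := min (a / 2) (s / 2) with hrdef
  have hr0 : 0 < r := lt_min (by linarith) (by linarith)
  have hra : r < a := lt_of_le_of_lt (min_le_left _ _) (by linarith)
  have hrs : r ≤ s / 2 := min_le_right _ _
  have hr2 : r ^ 2 < tS c := by nlinarith
  have := h r ⟨hr0, hra⟩
  exact absurd this (not_lt.2 ((suydamFun_neg_iff_sq_lt hc hr0).2 hr2).le)

/-! ## §3 Newcomb–Suydam necessity applied: a negative-energy internal displacement of helicity `(m, k)` resonant in the core -/

/-- `F = k·B = k + m·c/(1 + r²)` off the axis. [cite: Freidberg2014, §11.5.1 eq. (11.90)] -/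
theorem kDotB_eq (m k : ℝ) {r : ℝ} (hr : r ≠ 0) : (eqProfile c δ).kDotB m k r = k + m * c / (1 + r ^ 2) := by
  have h1 : (1 : ℝ) + r ^ 2 ≠ 0 := by positivity
  show k * 1 + m * (r * (c / (1 + r ^ 2))) / r = k + m * c / (1 + r ^ 2)
  field_simp

/-- `F′ = −2mcr/(1 + r²)²` off the axis. [cite: Freidberg2014, §11.5.1 eq. (11.90)] -/
theorem deriv_kDotB (m k : ℝ) {r : ℝ} (hr : r ≠ 0) :
    deriv ((eqProfile c δ).kDotB m k) r = -(2 * m * c * r) / (1 + r ^ 2) ^ 2 := by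
  have hev : (eqProfile c δ).kDotB m k =ᶠ[nhds r] fun s => k + m * c / (1 + s ^ 2) := by
    filter_upwards [eventually_ne_nhds hr] with s hs
    exact kDotB_eq m k hs
  rw [hev.deriv_eq]
  have h1 : (1 : ℝ) + r ^ 2 ≠ 0 := by positivity
  have hin : HasDerivAt (fun s : ℝ => 1 + s ^ 2) (0 + (2 : ℕ) * r ^ (2 - 1)) r :=
    (hasDerivAt_const r (1 : ℝ)).add (hasDerivAt_pow 2 r)
  have h : HasDerivAt (fun s : ℝ => k + m * c / (1 + s ^ 2))
      (0 + (0 * (1 + r ^ 2) - m * c * (0 + (2 : ℕ) * r ^ (2 - 1))) / (1 + r ^ 2) ^ 2) r :=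
    (hasDerivAt_const r k).add ((hasDerivAt_const r (m * c)).div hin h1)
  rw [h.deriv]
  push_cast
  field_simp
  ring

/-- **NEGATIVE-ENERGY INTERNAL DISPLACEMENT** (tree theorem `ScrewPinch.Profile.suydamNecessity_holds`, Newcomb 1960 /
Freidberg §11.5.2): if `0 < r₀ < a` lies in the Suydam-violating core, `r₀² < t_S(c)`, then for every `m ≠ 0` the mode
`(m, k)` RESONANT at `r₀` (`k = −mc/(1 + r₀²)`) has a `C¹` radial trial displacement, compactly supported in `(0, a)`, with
NEGATIVE reduced ideal energy `∫₀ᵃ (f ξ′² + g ξ²) dr < 0`.  MODELLED: straight cylinder, ideal MHD; nothing about a device.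
[cite: Freidberg2014, §11.5.2 eq. (11.109)] -/
theorem exists_negative_energy (hc : c ≠ 0) {a r₀ m : ℝ} (hr₀ : 0 < r₀) (hr₀a : r₀ < a) (hm : m ≠ 0)
    (hcore : r₀ ^ 2 < tS c) :
    ∃ ξ : ℝ → ℝ, ContDiff ℝ 1 ξ ∧ tsupport ξ ⊆ Ioo 0 a ∧
      (eqProfile c δ).fluidEnergy m (-(m * c) / (1 + r₀ ^ 2)) a ξ < 0 := by
  have h1 : (1 : ℝ) + r₀ ^ 2 ≠ 0 := by positivity
  refine ScrewPinch.Profile.suydamNecessity_holds (eqProfile c δ) a m (-(m * c) / (1 + r₀ ^ 2)) r₀ ⟨hr₀, hr₀a⟩ hm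
    ?_ ?_ ?_ ?_ ?_ ?_ ?_ ?_
  · -- B_θ ∈ C¹
    have : ContDiff ℝ 1 (fun r : ℝ => r * (c / (1 + r ^ 2))) :=
      contDiff_id.mul (contDiff_const.div (by fun_prop) (fun x => by positivity))
    exact this.contDiffOn
  · exact contDiff_const.contDiffOn
  · have : ContDiff ℝ 1 (fun r : ℝ => c ^ 2 / (2 * (1 + r ^ 2) ^ 2) - c ^ 2 / 8 + δ) :=
      ((contDiff_const.div (by fun_prop) (fun x => by positivity)).sub contDiff_const).add contDiff_const
    exact this.contDiffOn
  · show r₀ * (c / (1 + r₀ ^ 2)) ≠ 0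
    have : 0 < 1 + r₀ ^ 2 := by positivity
    exact mul_ne_zero hr₀.ne' (div_ne_zero hc this.ne')
  · show (1 : ℝ) ≠ 0
    norm_num
  · rw [kDotB_eq m _ hr₀.ne']
    field_simp
    ring
  · rw [deriv_kDotB m _ hr₀.ne']
    have : 0 < (1 + r₀ ^ 2) ^ 2 := by positivity
    have hnum : 2 * m * c * r₀ ≠ 0 := by
      apply mul_ne_zero (mul_ne_zero (mul_ne_zero two_ne_zero hm) hc) hr₀.ne'
    intro h0
    rw [div_eq_zero_iff] at h0
    rcases h0 with h0 | h0
    · exact hnum (neg_eq_zero.1 h0)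
    · exact this.ne' h0
  · exact (suydamFun_neg_iff_sq_lt hc hr₀).2 hcore

/-! ## §4 The toroidal context (kernel remark): the large-aspect-ratio circular-tokamak Mercier function of the SAME
`q = (1 + r²)/(R₀c)`-type profile (`q > 1`) and pressure (`p′ < 0`) is POSITIVE everywhere — the `(1 − q²)` factor -/

/-- The same profiles as tree `Mercier.RadialProfile` data (`B_φ = 1`, `q = q₀(1 + r²)`, the force-balance pressure).
[instance data] -/
def radialProfile (q₀ c δ : ℝ) : Mercier.RadialProfile :=
  { μ₀ := 1, Bφ := 1, q := fun r => q₀ * (1 + r ^ 2), p := fun r => c ^ 2 / (2 * (1 + r ^ 2) ^ 2) - c ^ 2 / 8 + δ }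

/-- **TOROIDAL REVERSAL**: for `q₀ > 1`, `c ≠ 0` the circular-tokamak Mercier function `(rq′/q)² + 8μ₀ r p′(1 − q²)/B_φ²`
of these profiles is POSITIVE at every `r > 0` (tree remark `mercierCircularFun_pos_of_one_lt_q`: `q > 1`, `p′ < 0`), hence
`MercierCircularCriterion a` for every `a` — where the CYLINDER's Suydam function is negative in the core (§2).
MODELLED: `ε ≪ 1` tokamak ordering of Freidberg §12.5.4; not a statement about MODEL M's cylinder. [cite: Freidberg2014, §12.5.4 eq. (12.86)] -/
theorem mercierCircular_pos {q₀ : ℝ} (hq₀ : 1 < q₀) (hc : c ≠ 0) {r : ℝ} (hr : 0 < r) :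
    0 < (radialProfile q₀ c δ).mercierCircularFun r := by
  have hp : HasDerivAt (radialProfile q₀ c δ).p (-(2 * c ^ 2 * r) / (1 + r ^ 2) ^ 3) r := hasDerivAt_p (δ := δ) r
  refine Mercier.RadialProfile.mercierCircularFun_pos_of_one_lt_q _ hr (by show (0:ℝ) < 1; norm_num)
    (by show (1:ℝ) ≠ 0; norm_num) ?_ ?_
  · show 1 < q₀ * (1 + r ^ 2)
    nlinarith [sq_nonneg r]
  · rw [hp.deriv]
    have hc2 : 0 < c ^ 2 := by positivity
    have : 0 < (1 + r ^ 2) ^ 3 := by positivity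
    exact div_neg_of_neg_of_pos (by nlinarith [mul_pos hc2 hr]) this

/-- Hence the circular-tokamak Mercier criterion holds on `(0, a)` for every `a`. [cite: Freidberg2014, §12.5.4 eq. (12.86)] -/
theorem mercierCircularCriterion {q₀ : ℝ} (hq₀ : 1 < q₀) (hc : c ≠ 0) (a : ℝ) :
    (radialProfile q₀ c δ).MercierCircularCriterion a :=
  fun _ hr => mercierCircular_pos hq₀ hc hr.1

end EqSuydam

end TearingFRS1

end Summit.Ventures.FusionMHD.Models

end
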